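import Mathlib
import Summits.ResolutionOfSingularities.ResolutionOfSingularities.Theorems.WeightedInvariantHomogeneousMinimalPrimes
import HarnessLib

/-!
# Graded chart reading, I: the pure algebra (transport of gradings, homogeneous prime avoidance,
# homogeneous local generators)

Cell `res-hironaka`, line `L W4.3`, door crux `HypersurfaceCentreConstruction` (stmt-ResolutionOfSingularities-19897),
E2 tier, piece (C-a) `E2MaxNonemptyBody`, residual (γ) «attainment of `mu₂`» of ORDER (o47-a) (res-D-pv-031); first of
the three «graded chart reading» files announced 2026-08-27T18:42Z (shared with (C-b)/(S-c)).  Pure commutative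
algebra, OURS / folklore; nothing here is a statement of [Hironaka2017]; AI-written, weaker than expert review.

* `nonempty_gradedRing_of_mem_iff` — **a grading transports along any family of sub-objects with the same members**
  (e.g. `AddSubgroup` pieces ↔ `Submodule ℤ` pieces): graded monoid and decomposition carried over;
* `exists_isHomogeneousElem_mem_not_mem` — a homogeneous ideal not contained in `P` has a homogeneous element
  outside `P`;
* `exists_isHomogeneousElem_not_mem_forall_mem_minimalPrimes` — **homogeneous prime avoidance** in a Noetherian
  `ℤʲ`-graded ring: for a prime `P` there is a homogeneous `g ∉ P` lying in every minimal prime not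
  contained in `P` (the minimal primes are homogeneous, `Theorems.isHomogeneous_of_mem_minimalPrimes`; finitely
  many; their intersection is homogeneous and not inside `P`) — inverting `g` discards the irreducible components
  not through the point of `P`;
* `isHomogeneous_colon` — the colon `(J : I)` of homogeneous ideals is homogeneous (cancellative degrees);
* `exists_mem_span_singleton_eq_of_span_eq` — in a LOCAL ring a generating set of a principal ideal contains a
  generator (Nakayama for one generator);
* `exists_isHomogeneousElem_map_eq_span` — **homogeneous local generator**: if a homogeneous ideal `I` becomes
  principal in `A_P` (`P` prime) then it is generated there by the image of ONE HOMOGENEOUS `F ∈ I`;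
* `exists_isHomogeneousElem_not_mem_smul_le` — … and then some homogeneous `g' ∉ P` has `g' • I ≤ (F)` (Noetherian
  `A`), so `I` becomes `(F)` in every algebra in which `g'` is invertible (`map_eq_span_of_smul_le`).

[folklore; Bruns–Herzog §1.5, Atiyah–Macdonald Ch. 3]
-/

set_option linter.dupNamespace false -- mandated namespace of this single-conjunct summit

open DirectSum

namespace Summit.ResolutionOfSingularities.ResolutionOfSingularities.Theorems.GradedChart

/-! ## Transport of a grading along a family with the same members -/

section Transport

variable {ι A σ σ' : Type*} [DecidableEq ι] [AddMonoid ι] [CommRing A] [SetLike σ A] [AddSubmonoidClass σ A]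
  [SetLike σ' A] [AddSubmonoidClass σ' A] (𝒜 : ι → σ) (𝒜' : ι → σ') [GradedRing 𝒜]

/-- **Transport of a grading**: if `x ∈ 𝒜' i ↔ x ∈ 𝒜 i` for all `i, x`, then the family `𝒜'` also grades the
ring. [folklore] -/
theorem nonempty_gradedRing_of_mem_iff (h : ∀ i x, x ∈ 𝒜' i ↔ x ∈ 𝒜 i) : Nonempty (GradedRing 𝒜') := by
  classical
  have hgm : SetLike.GradedMonoid 𝒜' :=
    { one_mem := (h 0 1).mpr (SetLike.one_mem_graded 𝒜)
      mul_mem := fun i j a b ha hb =>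
        (h (i + j) (a * b)).mpr (SetLike.mul_mem_graded ((h i a).mp ha) ((h j b).mp hb)) }
  -- the piecewise identifications
  let e : ∀ i, 𝒜 i →+ 𝒜' i := fun i =>
    { toFun := fun x => ⟨x, (h i x).mpr x.2⟩
      map_zero' := Subtype.ext rfl
      map_add' := fun _ _ => Subtype.ext rfl }
  let g : (⨁ i, 𝒜 i) →+ ⨁ i, 𝒜' i :=
    DirectSum.toAddMonoid fun i => (DirectSum.of (fun i => 𝒜' i) i).comp (e i)
  have hg : ∀ (i : ι) (x : 𝒜 i), g (DirectSum.of (fun i => 𝒜 i) i x) =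
      DirectSum.of (fun i => 𝒜' i) i (e i x) := by
    intro i x
    simp only [g, DirectSum.toAddMonoid_of, AddMonoidHom.coe_comp, Function.comp_apply]
  let φ : A →+ ⨁ i, 𝒜' i :=
    { toFun := fun a => g (decompose 𝒜 a)
      map_zero' := by simp
      map_add' := fun a b => by simp [decompose_add] }
  have hφ : ∀ a, φ a = g (decompose 𝒜 a) := fun _ => rfl
  have left : (DirectSum.coeAddMonoidHom 𝒜').comp φ = AddMonoidHom.id A := by
    have key : (DirectSum.coeAddMonoidHom 𝒜').comp g = DirectSum.coeAddMonoidHom 𝒜 := by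
      refine DirectSum.addHom_ext fun i x => ?_
      rw [AddMonoidHom.comp_apply, hg, coeAddMonoidHom_of, coeAddMonoidHom_of]
      rfl
    ext a
    rw [AddMonoidHom.comp_apply, hφ, ← AddMonoidHom.comp_apply, key, AddMonoidHom.id_apply]
    exact (decompose 𝒜).symm_apply_apply a
  have right : φ.comp (DirectSum.coeAddMonoidHom 𝒜') = AddMonoidHom.id _ := by
    refine DirectSum.addHom_ext fun i y => ?_
    rw [AddMonoidHom.comp_apply, coeAddMonoidHom_of, AddMonoidHom.id_apply, hφ]
    have hy : (y : A) ∈ 𝒜 i := (h i y).mp y.2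
    rw [decompose_of_mem 𝒜 hy, hg]
    rfl
  exact ⟨{ hgm with toDecomposition := Decomposition.ofAddHom 𝒜' φ left right }⟩

omit [DecidableEq ι] [AddMonoid ι] [CommRing A] [AddSubmonoidClass σ A] [AddSubmonoidClass σ' A]
  [GradedRing 𝒜] in
/-- Homogeneity of an element transports along such a family. [folklore] -/
theorem isHomogeneousElem_of_mem_iff (h : ∀ i x, x ∈ 𝒜' i ↔ x ∈ 𝒜 i) {x : A}
    (hx : SetLike.IsHomogeneousElem 𝒜 x) : SetLike.IsHomogeneousElem 𝒜' x := by
  obtain ⟨i, hi⟩ := hx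
  exact ⟨i, (h i x).mpr hi⟩

/-- Homogeneity of an ideal transports along such a family (any graded-ring structure on `𝒜'`). [folklore] -/
theorem isHomogeneous_of_mem_iff [GradedRing 𝒜'] (h : ∀ i x, x ∈ 𝒜' i ↔ x ∈ 𝒜 i) {I : Ideal A}
    (hI : I.IsHomogeneous 𝒜) : I.IsHomogeneous 𝒜' := by
  obtain ⟨T, rfl⟩ := (Ideal.IsHomogeneous.iff_exists 𝒜 _).mp hI
  refine Ideal.homogeneous_span _ _ ?_
  rintro _ ⟨t, _, rfl⟩
  exact isHomogeneousElem_of_mem_iff 𝒜 𝒜' h t.2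

end Transport

/-! ## Homogeneous elements outside a prime; the colon of homogeneous ideals -/

section Avoid

variable {ι A σ : Type*} [DecidableEq ι] [CommRing A] [SetLike σ A] [AddSubmonoidClass σ A] (𝒜 : ι → σ)

/-- **A homogeneous ideal not contained in `P` has a homogeneous element outside `P`** (it is spanned by its
homogeneous elements). [folklore] -/
theorem exists_isHomogeneousElem_mem_not_mem [AddMonoid ι] [GradedRing 𝒜] {J P : Ideal A}
    (hJ : J.IsHomogeneous 𝒜) (hJP : ¬ J ≤ P) :
    ∃ x : A, SetLike.IsHomogeneousElem 𝒜 x ∧ x ∈ J ∧ x ∉ P := by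
  obtain ⟨T, hT⟩ := (Ideal.IsHomogeneous.iff_exists 𝒜 _).mp hJ
  by_contra hcon
  push Not at hcon
  apply hJP
  rw [hT, Ideal.span_le]
  rintro _ ⟨t, ht, rfl⟩
  exact hcon t t.2 (hT ▸ Ideal.subset_span ⟨t, ht, rfl⟩)

/-- **The colon `(J : I) = {a | a I ⊆ J}` of homogeneous ideals is homogeneous** (degrees in a cancellative
monoid: the component of degree `d + e` of `a x`, `x ∈ I` homogeneous of degree `e`, is `a_d x ∈ J`). [folklore] -/
theorem isHomogeneous_colon [AddCancelMonoid ι] [GradedRing 𝒜] {I J : Ideal A} (hI : I.IsHomogeneous 𝒜)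
    (hJ : J.IsHomogeneous 𝒜) : (J.colon I).IsHomogeneous 𝒜 := by
  classical
  intro d a ha
  rw [Submodule.mem_colon] at ha ⊢
  intro x hx
  -- decompose `x ∈ I` into its homogeneous components, all in `I`
  rw [← sum_support_decompose 𝒜 x, smul_eq_mul, Finset.mul_sum]
  refine J.sum_mem fun e _ => ?_
  have hxe : (decompose 𝒜 x e : A) ∈ I := hI e hx
  have hax : a * (decompose 𝒜 x e : A) ∈ J := ha _ hxe
  have hcomp := hJ (d + e) hax
  rwa [coe_decompose_mul_add_of_right_mem 𝒜 (SetLike.coe_mem (decompose 𝒜 x e))] at hcomp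

end Avoid

section Pi

variable {j : ℕ} {A : Type*} [CommRing A] (𝒜 : (Fin j → ℤ) → AddSubgroup A) [GradedRing 𝒜]

/-- **Homogeneous prime avoidance** (Noetherian `ℤʲ`-graded ring): for a prime `P` there is a homogeneous
`g ∉ P` contained in every minimal prime of `A` that is not contained in `P` (the minimal primes are homogeneous,
so is the intersection of those not inside `P`).  Inverting `g` discards exactly the irreducible components of
`Spec A` not passing through the point of `P`. [folklore] -/
theorem exists_isHomogeneousElem_not_mem_forall_mem_minimalPrimes [IsNoetherianRing A] {P : Ideal A}
    [hP : P.IsPrime] :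
    ∃ g : A, SetLike.IsHomogeneousElem 𝒜 g ∧ g ∉ P ∧ ∀ Q ∈ minimalPrimes A, ¬ Q ≤ P → g ∈ Q := by
  classical
  have hfin : (minimalPrimes A).Finite := minimalPrimes.finite_of_isNoetherianRing A
  let s : Finset (Ideal A) := (hfin.toFinset).filter fun Q => ¬ Q ≤ P
  have hs : ∀ Q, Q ∈ s ↔ Q ∈ minimalPrimes A ∧ ¬ Q ≤ P := fun Q => by
    simp only [s, Finset.mem_filter, Set.Finite.mem_toFinset]
  let J : Ideal A := s.inf id
  have hJh : J.IsHomogeneous 𝒜 := by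
    change (s.inf id).IsHomogeneous 𝒜
    rw [Finset.inf_eq_iInf]
    refine Ideal.IsHomogeneous.iInf₂ fun Q hQ => ?_
    exact isHomogeneous_of_mem_minimalPrimes 𝒜 (Ideal.IsHomogeneous.bot 𝒜) ((hs Q).mp hQ).1
  have hJP : ¬ J ≤ P := by
    intro hle
    obtain ⟨Q, hQs, hQP⟩ := (hP.inf_le'.mp hle)
    exact ((hs Q).mp hQs).2 hQP
  obtain ⟨g, hg, hgJ, hgP⟩ := exists_isHomogeneousElem_mem_not_mem 𝒜 hJh hJP
  refine ⟨g, hg, hgP, fun Q hQ hQP => ?_⟩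
  have hQs : Q ∈ s := (hs Q).mpr ⟨hQ, hQP⟩
  exact (Finset.inf_le hQs : J ≤ Q) hgJ

end Pi

/-! ## Homogeneous local generators -/

section LocalGenerator

/-- **In a local ring, a generating set of a principal ideal contains a generator**: if `span S = span {g}` with
`S` non-empty then `span {s} = span {g}` for some `s ∈ S`.  (Write `g = ∑ cᵢ sᵢ`, `sᵢ = bᵢ g`; if `∑ cᵢ bᵢ`
is a unit some `bᵢ` is a unit, else `g = 0`.) [folklore] -/
theorem exists_mem_span_singleton_eq_of_span_eq {R : Type*} [CommRing R] [IsLocalRing R] {S : Set R}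
    (hS : S.Nonempty) {g : R} (h : Ideal.span S = Ideal.span {g}) :
    ∃ s ∈ S, Ideal.span {s} = Ideal.span {g} := by
  classical
  have hg : g ∈ Ideal.span S := h ▸ Ideal.mem_span_singleton_self g
  obtain ⟨n, c, f, hsum⟩ := Submodule.mem_span_set'.mp hg
  -- each `f i ∈ S` is a multiple of `g`
  have hb : ∀ i, ∃ b : R, b * g = (f i : R) := fun i =>
    Ideal.mem_span_singleton'.mp (h ▸ Ideal.subset_span (f i).2)
  choose b hb using hb
  set u : R := ∑ i, c i * b i with hu
  have hug : u * g = g := by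
    rw [hu, Finset.sum_mul]
    conv_rhs => rw [← hsum]
    refine Finset.sum_congr rfl fun i _ => ?_
    rw [smul_eq_mul, mul_assoc, hb i]
  rcases IsLocalRing.isUnit_or_isUnit_one_sub_self u with hunit | hunit
  · -- some `c i * b i` is a unit, hence `b i` is
    have hex : ∃ i, IsUnit (c i * b i) := by
      by_contra hcon
      push Not at hcon
      apply (IsLocalRing.mem_maximalIdeal _).mp _ hunit
      rw [hu]
      exact Ideal.sum_mem _ fun i _ => (IsLocalRing.mem_maximalIdeal _).mpr (hcon i)
    obtain ⟨i, hi⟩ := hex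
    refine ⟨f i, (f i).2, ?_⟩
    rw [← hb i, Ideal.span_singleton_mul_left_unit (isUnit_of_mul_isUnit_right hi)]
  · -- `(1 - u) g = 0` with `1 - u` a unit: `g = 0`, and every element of `S` is `0`
    have hg0 : g = 0 := by
      have h1 : (1 - u) * g = 0 := by rw [sub_mul, one_mul, hug, sub_self]
      exact (hunit.mul_right_eq_zero).mp h1
    obtain ⟨s, hs⟩ := hS
    refine ⟨s, hs, ?_⟩
    have hs0 : s ∈ Ideal.span ({g} : Set R) := h ▸ Ideal.subset_span hs
    rw [hg0, Ideal.span_singleton_eq_bot.mpr rfl, Ideal.mem_bot] at hs0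
    rw [hs0, hg0]

variable {ι A σ : Type*} [DecidableEq ι] [CommRing A] [SetLike σ A] [AddSubmonoidClass σ A] (𝒜 : ι → σ)

/-- **Homogeneous local generator.**  If the homogeneous ideal `I` becomes principal in the localisation `L` of
`A` at a prime (any LOCAL algebra `L`), then it is generated there by the image of one HOMOGENEOUS element
`F ∈ I`. [folklore] -/
theorem exists_isHomogeneousElem_map_eq_span [AddMonoid ι] [GradedRing 𝒜] {L : Type*} [CommRing L]
    [IsLocalRing L] [Algebra A L]
    {I : Ideal A} (hI : I.IsHomogeneous 𝒜) {g : L} (hg : I.map (algebraMap A L) = Ideal.span {g}) :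
    ∃ F ∈ I, SetLike.IsHomogeneousElem 𝒜 F ∧ I.map (algebraMap A L) = Ideal.span {algebraMap A L F} := by
  obtain ⟨T, hT⟩ := (Ideal.IsHomogeneous.iff_exists 𝒜 _).mp hI
  by_cases hTe : T = ∅
  · -- `I = ⊥`
    have hI0 : I = ⊥ := by rw [hT, hTe, Set.image_empty, Ideal.span_empty]
    refine ⟨0, I.zero_mem, ⟨0, zero_mem _⟩, ?_⟩
    rw [hI0, Ideal.map_bot, map_zero, Ideal.span_singleton_eq_bot.mpr rfl]
  · have hne : ((algebraMap A L) '' (((↑) : _ → A) '' T)).Nonempty :=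
      ((Set.nonempty_iff_ne_empty.mpr hTe).image _).image _
    have hspan : Ideal.span ((algebraMap A L) '' (((↑) : _ → A) '' T)) = Ideal.span {g} := by
      rw [← Ideal.map_span (algebraMap A L), ← hT, hg]
    obtain ⟨_, ⟨_, ⟨t, htT, rfl⟩, rfl⟩, hs⟩ := exists_mem_span_singleton_eq_of_span_eq hne hspan
    refine ⟨t, hT ▸ Ideal.subset_span ⟨t, htT, rfl⟩, t.2, ?_⟩
    rw [hg, ← hs]

/-- **Homogeneous denominators for a homogeneous local generator** (Noetherian `A`): if `I` is homogeneous,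
`P` a prime not containing … — precisely: if `I` is generated in `A_P` by the image of `F`, then some HOMOGENEOUS
`g' ∉ P` satisfies `g' • I ≤ (F)` (the colon `((F) : I)` is homogeneous and not inside `P`). [folklore] -/
theorem exists_isHomogeneousElem_not_mem_smul_le [AddCancelMonoid ι] [GradedRing 𝒜] [IsNoetherianRing A]
    {I : Ideal A}
    (hI : I.IsHomogeneous 𝒜) (P : Ideal A) [hP : P.IsPrime] {F : A} (hF : SetLike.IsHomogeneousElem 𝒜 F)
    (hmap : I.map (algebraMap A (Localization.AtPrime P)) =
      Ideal.span {algebraMap A (Localization.AtPrime P) F}) :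
    ∃ g' : A, SetLike.IsHomogeneousElem 𝒜 g' ∧ g' ∉ P ∧ ∀ x ∈ I, g' * x ∈ Ideal.span {F} := by
  classical
  set L := Localization.AtPrime P
  -- the colon ideal is homogeneous
  have hcol : ((Ideal.span {F}).colon I).IsHomogeneous 𝒜 :=
    isHomogeneous_colon 𝒜 hI (Ideal.homogeneous_span 𝒜 {F} fun x hx => by
      rw [Set.mem_singleton_iff.mp hx]; exact hF)
  -- and not contained in `P`: every generator of `I` is a multiple of `F` after a denominator outside `P`
  have hden : ∀ x ∈ I, ∃ u : A, u ∉ P ∧ u * x ∈ Ideal.span {F} := by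
    intro x hx
    have hxL : algebraMap A L x ∈ Ideal.span {algebraMap A L F} := hmap ▸ Ideal.mem_map_of_mem _ hx
    obtain ⟨a, ha⟩ := Ideal.mem_span_singleton'.mp hxL
    obtain ⟨⟨c, d⟩, hcd⟩ := IsLocalization.surj P.primeCompl a
    -- `a = c / d`, so `d x = c F` up to a denominator
    have h1 : algebraMap A L (d * x) = algebraMap A L (c * F) := by
      rw [map_mul, map_mul, ← ha, ← hcd]
      ring
    obtain ⟨e, he⟩ := (IsLocalization.eq_iff_exists P.primeCompl L).mp h1
    refine ⟨e * d, ?_, ?_⟩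
    · exact fun h => (hP.mem_or_mem h).elim e.2 d.2
    · rw [mul_assoc, he, ← mul_assoc]
      exact Ideal.mul_mem_left _ _ (Ideal.mem_span_singleton_self F)
  have hcolP : ¬ (Ideal.span {F}).colon I ≤ P := by
    obtain ⟨T, hT⟩ := (‹IsNoetherianRing A›.noetherian I)
    -- `T` a finite generating set of `I`; multiply the denominators
    choose! u hu using hden
    intro hle
    have hprod : (∏ x ∈ T, u x) ∈ (Ideal.span {F}).colon I := by
      rw [Submodule.mem_colon]
      intro y hy
      rw [← hT] at hy
      refine Submodule.span_induction ?_ ?_ ?_ ?_ hy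
      · intro x hxT
        rw [smul_eq_mul, ← Finset.prod_erase_mul _ _ hxT, mul_assoc]
        exact Ideal.mul_mem_left _ _ (hu x (hT ▸ Ideal.subset_span hxT)).2
      · simp
      · intro a b _ _ ha hb
        rw [smul_add]
        exact Ideal.add_mem _ ha hb
      · intro r a _ ha
        rw [smul_comm]
        exact Ideal.mul_mem_left _ _ ha
    have hmem := hle hprod
    obtain ⟨x, hxT, hxP⟩ := (hP.prod_mem_iff.mp hmem)
    exact (hu x (hT ▸ Ideal.subset_span hxT)).1 hxP
  obtain ⟨g', hg', hg'c, hg'P⟩ := exists_isHomogeneousElem_mem_not_mem 𝒜 hcol hcolP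
  refine ⟨g', hg', hg'P, fun x hx => ?_⟩
  exact (Submodule.mem_colon.mp hg'c) x hx

/-- If `g' • I ≤ (F)` with `F ∈ I`, then `I` becomes `(F)` in every algebra in which `g'` is a unit. [folklore] -/
theorem map_eq_span_of_smul_le {B : Type*} [CommRing B] [Algebra A B] {I : Ideal A} {F g' : A} (hFI : F ∈ I)
    (hle : ∀ x ∈ I, g' * x ∈ Ideal.span {F}) (hunit : IsUnit (algebraMap A B g')) :
    I.map (algebraMap A B) = Ideal.span {algebraMap A B F} := by
  apply le_antisymm
  · rw [Ideal.map_le_iff_le_comap]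
    intro x hx
    obtain ⟨c, hc⟩ := Ideal.mem_span_singleton'.mp (hle x hx)
    rw [Ideal.mem_comap, Ideal.mem_span_singleton']
    obtain ⟨v, hv⟩ := hunit.exists_left_inv
    refine ⟨v * algebraMap A B c, ?_⟩
    calc v * algebraMap A B c * algebraMap A B F = v * algebraMap A B (c * F) := by rw [map_mul]; ring
      _ = v * algebraMap A B (g' * x) := by rw [hc]
      _ = algebraMap A B x := by rw [map_mul, ← mul_assoc, hv, one_mul]
  · rw [Ideal.span_le, Set.singleton_subset_iff]
    exact Ideal.mem_map_of_mem _ hFI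

end LocalGenerator

end Summit.ResolutionOfSingularities.ResolutionOfSingularities.Theorems.GradedChart
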